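import Summits.QuantumFields.BalabanUV.T4Continuum.Support.NE3HilbertSchmidtTorus
import HarnessLib

/-!
# NE7LinkFunctionalMinimiser — EXISTENCE OF THE LATTICE LANDAU-GAUGE REPRESENTATIVE BY MINIMISATION: on the `P`-periodic torus, for every configuration `U`,
# the link functional `u ↦ Σ_{b ∈ periodBox P} ‖U^{u}(b) − 1‖²` attains its minimum over the RESTRICTED gauge group (unitary, `P`-periodic, `u = 1` at the
# points `M•y`) — the nonlinear Landau representative of brick N3 of the REP♭ crux card, existence half (compactness); no estimate is claimed

Cell `pub-balaban`, rung (B)+1 sub-cell t4, lineage `b2b-balaban-t4-ne7-p1`, generation 72 (CRUX PROVER NE7 #1, OWNER row NE7).  File N3a of the REP♭ road (memo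
`t4/b2b-balaban-t4-ne7-p1-g72/HUNT-H16-GREEN-DISCHARGED.md` §9, `REP-FLAT-CRUX-CARD.md` §3): the one Bałaban TYPE left in the (APE) END at the trivial flat datum is a
gauge `u₀` in which the links of `U` are within `r₀ ≲ δ∕M` of `1` with differences `≲ δ∕M²` (G7 `NE7ApeTrivialFlatEndLinks`); [Balaban1985RegularSpaces] produces it as the
LANDAU-gauge representative (Theorem 2, by a contraction around the axial gauge).  The canonical lattice alternative is the MINIMISER of the link functional
`F_U(u) = Σ_b ‖U^{u}(b) − 1‖²` (lattice Landau gauge: its Euler–Lagrange equation is the exact lattice divergence condition `Σ_κ [A(x,κ) − A(x−e_κ,κ)] = 0` for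
`A = (U^u − (U^u)*)∕2` off the constrained points — NOT proved here).  THIS FILE proves that the minimum IS ATTAINED over the restricted group: the group is
parametrised by the torus sections `Sec d n P` of `NE3HilbertSchmidtTorus` (`u = extS P a`, automatically `P`-periodic), the constraint set
`{a | every value unitary, value 1 at the points M•y}` is closed and bounded in the finite-dimensional `Sec d n P` hence compact, the functional is continuous
(written multiplicatively, `‖u(x)U(x,κ) − u(x+e_κ)‖ = ‖U^{u}(x,κ) − 1‖` for unitary `u`, so no inverse enters), and `IsCompact.exists_isMinOn` applies.
WHAT ([folklore]; 0 def, 0 sorry; every dimension `d`, every `P ≥ 1`, every `M`, every `U` — no smallness, no periodicity of `U` needed for the statement).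
§1 `norm_mul_sub_eq_of_unitary` (the multiplicative rewriting), `continuous_extS_apply`, `norm_sq_le_one_of_unitary`; §2 **`exists_linkMinimiser`**:
`∃ u : Site d → (Matrix n n ℂ)ˣ`, unitary-valued, `P`-periodic, `u (M•y) = 1`, with `Σ_{x ∈ periodBox P} Σ_κ ‖U^{u}(x,κ) − 1‖² ≤ Σ_{x ∈ periodBox P} Σ_κ ‖U^{v}(x,κ) − 1‖²`
for every unitary `P`-periodic `v` with `v (M•y) = 1`.
HONEST FRAMING (page 1): EXISTENCE ONLY (compactness); the Euler–Lagrange equation, the sup bound `r₀ ≲ δ∕M` and the gradient bound (the content of [B8] Theorem 2 ∕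
bricks N3–N4) are NOT proved; REP♭ NOT proved; (APE) NOT proved unconditionally; NOT ONE-STEP, NOT NE7; spine 0∕9; finite T⁴ rung (B)+1 — NOT infinite volume, NOT
mass gap, NOT Clay.  Continuum YM on T⁴ ⇐ BetaPertH ∧ nine spine estimates (0/9 proved); BetaPertH ⇐ (D1) ∧ (D4) ∧ CAP+tail; G-an2-4 gates asym, D1 and NE2/3/4.
-/

set_option autoImplicit false

open scoped BigOperators Matrix.Norms.L2Operator
open NormedSpace Finset

namespace Summit.QuantumFields.BalabanUV.T4Continuum.NE7LinkFunctionalMinimiser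

open Literature.MathematicalPhysics.QuantumFieldTheory.Balaban1983to89
open B7Prop1Explicit B7Prop2Explicit MatrixNorms
open T4AveragingDeficitWallBoundary (periodBox)
open AveragingDeficitTorusChart (redN redN_add_smul)
open NE3HilbertSchmidtTorus (HSMat Sec extS resS extS_resS extS_boxVec extS_add_period)
open NE3HilbertSchmidtTorus.HSMat (toHS ofHS ofHS_toHS ofHS_add ofHS_smul norm_sq_eq)

noncomputable section

variable {d : ℕ} {n : Type*} [Fintype n] [DecidableEq n]

/-! ## §1 Three small facts -/

/-- **THE LINK FUNCTIONAL WITHOUT INVERSES**: for unitary `g'`, `‖g·W·g'⋆ − 1‖ = ‖g·W − g'‖`. [folklore] -/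
theorem norm_mul_sub_eq_of_unitary [Nonempty n] (g W : Matrix n n ℂ) {g' : Matrix n n ℂ} (hg' : g' ∈ unitary (Matrix n n ℂ)) :
    ‖g * W * star g' - 1‖ = ‖g * W - g'‖ := by
  letI : CStarAlgebra (Matrix n n ℂ) := {}
  have h1 : g * W * star g' - 1 = (g * W - g') * star g' := by
    rw [sub_mul, Unitary.mul_star_self_of_mem hg']
  rw [h1, CStarRing.norm_mul_mem_unitary _ (Unitary.star_mem hg')]

/-- Evaluation of the periodic extension of a torus section at a site is continuous in the section. [folklore] -/
theorem continuous_extS_apply (P : ℕ) [NeZero P] (x : Site d) : Continuous fun a : Sec d n P => extS P a x := by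
  let f : HSMat n →ₗ[ℝ] Matrix n n ℂ := { toFun := ofHS, map_add' := ofHS_add, map_smul' := ofHS_smul }
  have hf : Continuous f := f.continuous_of_finiteDimensional
  exact hf.comp (PiLp.continuous_apply 2 _ (redN P x))

/-- A torus section value whose matrix is unitary has Hilbert–Schmidt norm at most `1`. [folklore] -/
theorem norm_sq_le_one_of_unitary [Nonempty n] {A : HSMat n} (hA : ofHS A ∈ unitary (Matrix n n ℂ)) : ‖A‖ ^ 2 ≤ 1 := by
  letI : CStarAlgebra (Matrix n n ℂ) := {}
  rw [norm_sq_eq]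
  have h1 : ‖ofHS A‖ = 1 := CStarRing.norm_coe_unitary ⟨ofHS A, hA⟩
  calc nhsNormSq (ofHS A) ≤ ‖ofHS A‖ ^ 2 := nhsNormSq_le_opNorm_sq _
    _ = 1 := by rw [h1, one_pow]

/-! ## §2 The minimiser exists -/

/-- **THE LINK FUNCTIONAL ATTAINS ITS MINIMUM OVER THE RESTRICTED GAUGE GROUP** (every `d`, `P ≥ 1`, `M`, `U`): there is a unitary-valued `P`-periodic site gauge
`u` with `u (M•y) = 1` for all `y` such that `Σ_{x ∈ periodBox P} Σ_κ ‖U^{u}(x,κ) − 1‖² ≤ Σ_{x ∈ periodBox P} Σ_κ ‖U^{v}(x,κ) − 1‖²` for every unitary-valued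
`P`-periodic `v` with `v (M•y) = 1` for all `y` — the lattice Landau-gauge representative of `U` by minimisation (existence only). [folklore] -/
theorem exists_linkMinimiser [Nonempty n] (P : ℕ) [NeZero P] (M : ℤ) (U : Site d → Fin d → (Matrix n n ℂ)ˣ) :
    ∃ u : Site d → (Matrix n n ℂ)ˣ, (∀ x, u x ∈ unitaryUnits (Matrix n n ℂ)) ∧ (∀ (x : Site d) (τ : Fin d), u (x + (P : ℤ) • e τ) = u x) ∧
      (∀ y : Site d, u (M • y) = 1) ∧
      ∀ v : Site d → (Matrix n n ℂ)ˣ, (∀ x, v x ∈ unitaryUnits (Matrix n n ℂ)) → (∀ (x : Site d) (τ : Fin d), v (x + (P : ℤ) • e τ) = v x) →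
        (∀ y : Site d, v (M • y) = 1) →
        ∑ x ∈ periodBox (d := d) P, ∑ κ : Fin d, ‖((gaugeAct u U x κ : (Matrix n n ℂ)ˣ) : Matrix n n ℂ) - 1‖ ^ 2
          ≤ ∑ x ∈ periodBox (d := d) P, ∑ κ : Fin d, ‖((gaugeAct v U x κ : (Matrix n n ℂ)ˣ) : Matrix n n ℂ) - 1‖ ^ 2 := by
  letI : CStarAlgebra (Matrix n n ℂ) := {}
  -- the functional on torus sections, written without inverses
  let Φ : Sec d n P → ℝ := fun a =>
    ∑ x ∈ periodBox (d := d) P, ∑ κ : Fin d, ‖extS P a x * ((U x κ : (Matrix n n ℂ)ˣ) : Matrix n n ℂ) - extS P a (x + e κ)‖ ^ 2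
  have hΦ : Continuous Φ := by
    refine continuous_finsetSum _ fun x _ => continuous_finsetSum _ fun κ _ => ?_
    exact (((continuous_extS_apply P x).mul continuous_const).sub (continuous_extS_apply P (x + e κ))).norm.pow 2
  -- the constraint set: unitary values, value `1` at the points `M • y`
  let K : Set (Sec d n P) := {a | ∀ x : Site d, extS P a x ∈ unitary (Matrix n n ℂ) ∧ ((∃ y : Site d, x = M • y) → extS P a x = 1)}
  have hKclosed : IsClosed K := by
    have hK : K = ⋂ x : Site d, ({a : Sec d n P | extS P a x ∈ unitary (Matrix n n ℂ)} ∩ {a | (∃ y : Site d, x = M • y) → extS P a x = 1}) := by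
      ext a; simp only [K, Set.mem_setOf_eq, Set.mem_iInter, Set.mem_inter_iff]
    rw [hK]
    refine isClosed_iInter fun x => IsClosed.inter (isClosed_unitary.preimage (continuous_extS_apply P x)) ?_
    by_cases hx : ∃ y : Site d, x = M • y
    · have : {a : Sec d n P | (∃ y : Site d, x = M • y) → extS P a x = 1} = {a | extS P a x = 1} := by
        ext a; simp only [Set.mem_setOf_eq]; exact ⟨fun h => h hx, fun h _ => h⟩
      rw [this]; exact isClosed_eq (continuous_extS_apply P x) continuous_const
    · have : {a : Sec d n P | (∃ y : Site d, x = M • y) → extS P a x = 1} = Set.univ := by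
        ext a; simp only [Set.mem_setOf_eq, Set.mem_univ, iff_true]; exact fun h => absurd h hx
      rw [this]; exact isClosed_univ
  have hKbdd : Bornology.IsBounded K := by
    rw [isBounded_iff_forall_norm_le]
    refine ⟨Real.sqrt (Fintype.card (Fin d → Fin P)), fun a ha => ?_⟩
    rw [PiLp.norm_eq_of_L2]
    refine Real.sqrt_le_sqrt ?_
    calc ∑ s : Fin d → Fin P, ‖a s‖ ^ 2 ≤ ∑ _s : Fin d → Fin P, (1 : ℝ) := Finset.sum_le_sum fun s _ => by
            have h := (ha (boxVec P s)).1
            rw [extS_boxVec] at h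
            exact norm_sq_le_one_of_unitary h
      _ = Fintype.card (Fin d → Fin P) := by rw [Finset.sum_const, Finset.card_univ, nsmul_eq_mul, mul_one]
  have hKc : IsCompact K := Metric.isCompact_of_isClosed_isBounded hKclosed hKbdd
  -- the trivial gauge belongs to `K`
  have hK1 : (resS P (fun _ : Site d => (1 : Matrix n n ℂ))) ∈ K := by
    have h1 : extS P (resS P (fun _ : Site d => (1 : Matrix n n ℂ))) = fun _ => 1 := extS_resS P (fun _ _ => rfl)
    intro x
    rw [h1]
    exact ⟨(unitary (Matrix n n ℂ)).one_mem, fun _ => rfl⟩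
  obtain ⟨a₀, ha₀K, hmin⟩ := hKc.exists_isMinOn ⟨_, hK1⟩ hΦ.continuousOn
  -- the minimiser as a units-valued site gauge
  let u : Site d → (Matrix n n ℂ)ˣ := fun x =>
    ⟨extS P a₀ x, star (extS P a₀ x), Unitary.mul_star_self_of_mem (ha₀K x).1, Unitary.star_mul_self_of_mem (ha₀K x).1⟩
  have hu_val : ∀ x, ((u x : (Matrix n n ℂ)ˣ) : Matrix n n ℂ) = extS P a₀ x := fun _ => rfl
  have hu_inv : ∀ x, (((u x)⁻¹ : (Matrix n n ℂ)ˣ) : Matrix n n ℂ) = star (extS P a₀ x) := fun _ => rfl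
  refine ⟨u, fun x => mem_unitaryUnits.mpr (ha₀K x).1, fun x τ => Units.ext ?_, fun y => Units.ext ?_, fun v hvu hvP hvc => ?_⟩
  · rw [hu_val, hu_val, extS_add_period]
  · rw [hu_val, Units.val_one]; exact (ha₀K _).2 ⟨y, rfl⟩
  -- the competitor as a torus section
  have hvext : extS P (resS P (fun x => ((v x : (Matrix n n ℂ)ˣ) : Matrix n n ℂ))) = fun x => ((v x : (Matrix n n ℂ)ˣ) : Matrix n n ℂ) :=
    extS_resS P (fun x τ => by rw [hvP x τ])
  have hvK : resS P (fun x => ((v x : (Matrix n n ℂ)ˣ) : Matrix n n ℂ)) ∈ K := by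
    intro x
    rw [hvext]
    exact ⟨mem_unitaryUnits.mp (hvu x), fun ⟨y, hy⟩ => by subst hy; dsimp only; rw [hvc y, Units.val_one]⟩
  have hle := hmin hvK
  -- identify the functional with the link sums
  have hΦu : Φ a₀ = ∑ x ∈ periodBox (d := d) P, ∑ κ : Fin d, ‖((gaugeAct u U x κ : (Matrix n n ℂ)ˣ) : Matrix n n ℂ) - 1‖ ^ 2 := by
    refine Finset.sum_congr rfl fun x _ => Finset.sum_congr rfl fun κ _ => ?_
    rw [show ((gaugeAct u U x κ : (Matrix n n ℂ)ˣ) : Matrix n n ℂ) = extS P a₀ x * ((U x κ : (Matrix n n ℂ)ˣ) : Matrix n n ℂ) * star (extS P a₀ (x + e κ)) by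
      unfold gaugeAct; rw [Units.val_mul, Units.val_mul, hu_val, hu_inv], norm_mul_sub_eq_of_unitary _ _ (ha₀K _).1]
  have hΦv : Φ (resS P (fun x => ((v x : (Matrix n n ℂ)ˣ) : Matrix n n ℂ)))
      = ∑ x ∈ periodBox (d := d) P, ∑ κ : Fin d, ‖((gaugeAct v U x κ : (Matrix n n ℂ)ˣ) : Matrix n n ℂ) - 1‖ ^ 2 := by
    refine Finset.sum_congr rfl fun x _ => Finset.sum_congr rfl fun κ _ => ?_
    rw [hvext]
    rw [show ((gaugeAct v U x κ : (Matrix n n ℂ)ˣ) : Matrix n n ℂ)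
        = ((v x : (Matrix n n ℂ)ˣ) : Matrix n n ℂ) * ((U x κ : (Matrix n n ℂ)ˣ) : Matrix n n ℂ) * star ((v (x + e κ) : (Matrix n n ℂ)ˣ) : Matrix n n ℂ) by
      unfold gaugeAct; rw [Units.val_mul, Units.val_mul, AveragingDeficitTransport.val_inv_eq_star_of_unitary (hvu _)],
      norm_mul_sub_eq_of_unitary _ _ (mem_unitaryUnits.mp (hvu _))]
  rw [← hΦu, ← hΦv]
  exact hle

end

end Summit.QuantumFields.BalabanUV.T4Continuum.NE7LinkFunctionalMinimiser
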